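import Summits.ValiantsHypothesis.ValiantsHypothesis.Theorems.SymPencilPerFourTwoRowsRadical
import Summits.ValiantsHypothesis.ValiantsHypothesis.Theorems.SymPencilPerFourHessianMinors
import Mathlib.LinearAlgebra.FiniteDimensional.Lemmas

/-!
# Route `SymPencil` — inner rank of the `2 | 2` row split of `per_4`, I: the permanent by rows,
# the one-parameter-pair family, column bookkeeping
# (`--supports` stmt-ValiantsHypothesis-5674 `SdcSuperquadratic`; toward the cell hypothesis `H88` /
# Task T2 of `Cruxes/SdcSuperquadratic/NEXT-RUNG-25.md`; rung currency only)

SETTING (shared by `SymPencilPerFourInnerRankFamily`, `SymPencilPerFourInnerRankNine`).  Write a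
`4 × 4` matrix by its rows `(a, b, y₂, y₃)`, `u = (a, b)`, `y = (y₂, y₃)`.  A JOINT `8`-SQUARE
FAMILY for the biquadratic form `per (a; b; y₂; y₃)` is `c : Fin 8 → K` and bilinear forms
`t_r (u, y)` (`r < 8`) with `Σ_r c_r t_r(u, y)² = per (a; b; y₂; y₃)` identically ("inner rank
`≤ 8`") — what the kernel package of a size-`25` symmetric affine determinantal representation of
`per_4` with an `8`-dimensional kernel would deliver (`SymPencilSdcPerFourTwentySixReduction`,
hypothesis `H88`).  The three files prove that no such family exists in characteristic `0`.

THIS FILE (no hypothesis on `t` beyond bilinearity):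
* `permanent_of_rows` and corollaries — multilinearity, symmetry and vanishing of
  `per (a; b; v; w)` in its rows; `per (𝟙; 𝟙; v; w) = 2((Σv)(Σw) - v·w)` and its non-degeneracy
  (`eq_zero_of_per_ones`);
* the FAMILY `u = (a, β e₂ + γ e₃)`: `k = β e₂ - γ e₃` is a kernel vector of the pairing
  `(v, w) ↦ per (a; b; v; w)` (`per_family_kernel`), the pairing has corank exactly one when
  `a₀ a₁ β γ (a₂ γ + a₃ β) ≠ 0` (`kernel_family`), and `per (a; e₀; k; k) = -2 a₁ β γ`
  (`per_family_deriv`);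
* polynomiality along lines of `z ↦ B(φ z, ψ z)` and of the non-degeneracy polynomial
  (`linePoly_bilin`, `linePoly_good`), for `SymPencilPerFourHessianMinors.forall_eq_zero_or_of_mul₃`;
* COLUMN BOOKKEEPING (`columns_of_caseA`, `columns_of_caseB`): if `t_r((a, b), (b₂ e₂ - b₃ e₃, 0))
  = 0` on the whole family, then `t_r((a,0),(e₂,0)) = t_r((a,0),(e₃,0)) = 0`,
  `t_r((0,e₂),(e₂,0)) = t_r((0,e₃),(e₃,0)) = 0`, `t_r((0,e₃),(e₂,0)) = t_r((0,e₂),(e₃,0))`;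
  likewise in the `y₃`-slot.

Honest framing: lemmas; the tree's value `sdc(per_4) ≥ 25` is unchanged here; the crux
`SdcSuperquadratic` (a bound past the number-of-variables wall) and `VP ≠ VNP` are untouched.
No definitions, no named facts. [folklore]
-/

noncomputable section

-- single-conjunct layout: Sub = Summit, duplicated namespace component intended
set_option linter.dupNamespace false

namespace Summit.ValiantsHypothesis.ValiantsHypothesis.Theorems.SymPencilPerFourInnerRankRows

open Matrix Finset Module Polynomial

variable {K : Type*} [Field K]
/-! ### The permanent by rows -/

/-- The permanent of the `4 × 4` matrix with rows `a, b, v, w`, expanded. [folklore] -/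
theorem permanent_of_rows (a b v w : Fin 4 → K) :
    (Matrix.of ![a, b, v, w]).permanent =
      a 0 * (b 1 * (v 2 * w 3 + v 3 * w 2) + b 2 * (v 1 * w 3 + v 3 * w 1) +
          b 3 * (v 1 * w 2 + v 2 * w 1)) +
      a 1 * (b 0 * (v 2 * w 3 + v 3 * w 2) + b 2 * (v 0 * w 3 + v 3 * w 0) +
          b 3 * (v 0 * w 2 + v 2 * w 0)) +
      a 2 * (b 0 * (v 1 * w 3 + v 3 * w 1) + b 1 * (v 0 * w 3 + v 3 * w 0) +
          b 3 * (v 0 * w 1 + v 1 * w 0)) +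
      a 3 * (b 0 * (v 1 * w 2 + v 2 * w 1) + b 1 * (v 0 * w 2 + v 2 * w 0) +
          b 2 * (v 0 * w 1 + v 1 * w 0)) := by
  rw [Matrix.permanent_fin_four_row]
  simp [Matrix.of_apply]

/-- Additivity of `per (a; b; v; w)` in the row `b`. [folklore] -/
theorem per_add_row₁ (a b b' v w : Fin 4 → K) :
    (Matrix.of ![a, b + b', v, w]).permanent =
      (Matrix.of ![a, b, v, w]).permanent + (Matrix.of ![a, b', v, w]).permanent := by
  simp only [permanent_of_rows, Pi.add_apply]; ring

/-- Additivity of `per (a; b; v; w)` in the row `v`. [folklore] -/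
theorem per_add_row₂ (a b v v' w : Fin 4 → K) :
    (Matrix.of ![a, b, v + v', w]).permanent =
      (Matrix.of ![a, b, v, w]).permanent + (Matrix.of ![a, b, v', w]).permanent := by
  simp only [permanent_of_rows, Pi.add_apply]; ring

/-- Additivity of `per (a; b; v; w)` in the row `w`. [folklore] -/
theorem per_add_row₃ (a b v w w' : Fin 4 → K) :
    (Matrix.of ![a, b, v, w + w']).permanent =
      (Matrix.of ![a, b, v, w]).permanent + (Matrix.of ![a, b, v, w']).permanent := by
  simp only [permanent_of_rows, Pi.add_apply]; ring

/-- Homogeneity of `per (a; b; v; w)` in the row `v`. [folklore] -/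
theorem per_smul_row₂ (a b v w : Fin 4 → K) (s : K) :
    (Matrix.of ![a, b, s • v, w]).permanent = s * (Matrix.of ![a, b, v, w]).permanent := by
  simp only [permanent_of_rows, Pi.smul_apply, smul_eq_mul]; ring

/-- Homogeneity of `per (a; b; v; w)` in the row `w`. [folklore] -/
theorem per_smul_row₃ (a b v w : Fin 4 → K) (s : K) :
    (Matrix.of ![a, b, v, s • w]).permanent = s * (Matrix.of ![a, b, v, w]).permanent := by
  simp only [permanent_of_rows, Pi.smul_apply, smul_eq_mul]; ring

/-- `per (a; b; v; w)` is symmetric in the rows `v, w`. [folklore] -/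
theorem per_swap_row₂₃ (a b v w : Fin 4 → K) :
    (Matrix.of ![a, b, w, v]).permanent = (Matrix.of ![a, b, v, w]).permanent := by
  simp only [permanent_of_rows]; ring

/-- `per (a; b; v; w)` is symmetric in the rows `a, b`. [folklore] -/
theorem per_swap_row₀₁ (a b v w : Fin 4 → K) :
    (Matrix.of ![b, a, v, w]).permanent = (Matrix.of ![a, b, v, w]).permanent := by
  simp only [permanent_of_rows]; ring

/-- A zero row `a` kills the permanent. [folklore] -/
theorem per_zero_row₀ (b v w : Fin 4 → K) : (Matrix.of ![0, b, v, w]).permanent = 0 := by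
  simp only [permanent_of_rows, Pi.zero_apply]; ring

/-- A zero row `v` kills the permanent. [folklore] -/
theorem per_zero_row₂ (a b w : Fin 4 → K) : (Matrix.of ![a, b, 0, w]).permanent = 0 := by
  simp only [permanent_of_rows, Pi.zero_apply]; ring

/-- A zero row `w` kills the permanent. [folklore] -/
theorem per_zero_row₃ (a b v : Fin 4 → K) : (Matrix.of ![a, b, v, 0]).permanent = 0 := by
  simp only [permanent_of_rows, Pi.zero_apply]; ring

/-- **The pairing at `a = b = 𝟙`:** `per (𝟙; 𝟙; v; w) = 2 ((Σ v)(Σ w) - v · w)`. [folklore] -/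
theorem per_ones (v w : Fin 4 → K) :
    (Matrix.of ![(fun _ => (1 : K)), (fun _ => (1 : K)), v, w]).permanent =
      2 * ((v 0 + v 1 + v 2 + v 3) * (w 0 + w 1 + w 2 + w 3) -
        (v 0 * w 0 + v 1 * w 1 + v 2 * w 2 + v 3 * w 3)) := by
  rw [permanent_of_rows]; ring

/-- `per (𝟙; 𝟙; v; e_l) = 2 (Σ v - v_l)`. [folklore] -/
theorem per_ones_single (v : Fin 4 → K) (l : Fin 4) :
    (Matrix.of ![(fun _ => (1 : K)), (fun _ => (1 : K)), v, Pi.single l 1]).permanent =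
      2 * ((v 0 + v 1 + v 2 + v 3) - v l) := by
  rw [per_ones]
  fin_cases l <;> simp

/-- If `per (𝟙; 𝟙; v; w) = 0` for every `w` then `v = 0` (characteristic `0`). [folklore] -/
theorem eq_zero_of_per_ones [CharZero K] (v : Fin 4 → K)
    (h : ∀ w, (Matrix.of ![(fun _ => (1 : K)), (fun _ => (1 : K)), v, w]).permanent = 0) :
    v = 0 := by
  have h0 := h (Pi.single 0 1)
  have h1 := h (Pi.single 1 1)
  have h2 := h (Pi.single 2 1)
  have h3 := h (Pi.single 3 1)
  rw [per_ones_single] at h0 h1 h2 h3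
  have hS : v 0 + v 1 + v 2 + v 3 = 0 := by
    have h6 : (6 : K) * (v 0 + v 1 + v 2 + v 3) = 0 := by linear_combination h0 + h1 + h2 + h3
    exact (mul_eq_zero.1 h6).resolve_left (by norm_num)
  have two : (2 : K) ≠ 0 := two_ne_zero
  funext l
  fin_cases l
  · have : (2 : K) * v 0 = 0 := by linear_combination 2 * hS - h0
    simpa [two] using this
  · have : (2 : K) * v 1 = 0 := by linear_combination 2 * hS - h1
    simpa [two] using this
  · have : (2 : K) * v 2 = 0 := by linear_combination 2 * hS - h2
    simpa [two] using this
  · have : (2 : K) * v 3 = 0 := by linear_combination 2 * hS - h3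
    simpa [two] using this

/-! ### The family `u = (a, β e₂ + γ e₃)`: kernel vector, corank one, derivative -/

/-- On the family, `k = β e₂ - γ e₃` is a kernel vector of the pairing:
`per (a; β e₂ + γ e₃; k; w) = 0` for every `w`. [folklore] -/
theorem per_family_kernel (a w : Fin 4 → K) (β γ : K) :
    (Matrix.of ![a, β • Pi.single (2 : Fin 4) (1 : K) + γ • Pi.single 3 1,
      β • Pi.single (2 : Fin 4) (1 : K) - γ • Pi.single 3 1, w]).permanent = 0 := by
  rw [permanent_of_rows]
  simp
  ring

/-- On the family the pairing has corank exactly one: if `per (a; β e₂ + γ e₃; v; w) = 0` for all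
`v` and `a₀ a₁ β γ (a₂ γ + a₃ β) ≠ 0`, then `w = (w₂ / β) • (β e₂ - γ e₃)`. [folklore] -/
theorem kernel_family [CharZero K] (a w : Fin 4 → K) (β γ : K)
    (hgood : a 0 * a 1 * β * γ * (a 2 * γ + a 3 * β) ≠ 0)
    (h : ∀ v, (Matrix.of ![a, β • Pi.single (2 : Fin 4) (1 : K) + γ • Pi.single 3 1,
      v, w]).permanent = 0) :
    w = (w 2 / β) • (β • Pi.single (2 : Fin 4) (1 : K) - γ • Pi.single 3 1) := by
  simp only [ne_eq, mul_eq_zero, not_or] at hgood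
  obtain ⟨⟨⟨⟨ha0, ha1⟩, hβ⟩, hγ⟩, hm⟩ := hgood
  have E0 := h (Pi.single 0 1)
  have E1 := h (Pi.single 1 1)
  have E2 := h (Pi.single 2 1)
  have E3 := h (Pi.single 3 1)
  rw [permanent_of_rows] at E0 E1 E2 E3
  simp at E0 E1 E2 E3
  -- `E2 : γ (a₁ w₀ + a₀ w₁) = 0`, `E0, E1` : the two long equations
  have hA : a 1 * w 0 + a 0 * w 1 = 0 := by
    have : γ * (a 1 * w 0 + a 0 * w 1) = 0 := by linear_combination E2
    exact (mul_eq_zero.1 this).resolve_left hγ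
  have hB : (a 2 * γ + a 3 * β) * (a 0 * w 1 - a 1 * w 0) = 0 := by
    linear_combination a 0 * E0 - a 1 * E1
  have hB' : a 0 * w 1 - a 1 * w 0 = 0 := (mul_eq_zero.1 hB).resolve_left hm
  have hw1 : w 1 = 0 := by
    have : (2 * a 0) * w 1 = 0 := by linear_combination hA + hB'
    exact (mul_eq_zero.1 this).resolve_left (mul_ne_zero two_ne_zero ha0)
  have hw0 : w 0 = 0 := by
    have : a 1 * w 0 = 0 := by linear_combination hA - a 0 * hw1
    exact (mul_eq_zero.1 this).resolve_left ha1
  have hw3 : w 3 = -(γ * w 2 / β) := by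
    have : a 1 * (γ * w 2 + β * w 3) = 0 := by
      linear_combination E0 - (a 2 * γ + a 3 * β) * hw1
    have h' : γ * w 2 + β * w 3 = 0 := (mul_eq_zero.1 this).resolve_left ha1
    field_simp
    linear_combination h'
  funext l
  fin_cases l
  · simp [hw0]
  · simp [hw1]
  · simp; field_simp
  · simp [hw3]; ring

/-- The derivative value on the family: `per (a; e₀; k; k) = -2 a₁ β γ` for `k = β e₂ - γ e₃`.
[folklore] -/
theorem per_family_deriv (a : Fin 4 → K) (β γ : K) :
    (Matrix.of ![a, Pi.single (0 : Fin 4) (1 : K),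
      β • Pi.single (2 : Fin 4) (1 : K) - γ • Pi.single 3 1,
      β • Pi.single (2 : Fin 4) (1 : K) - γ • Pi.single 3 1]).permanent = -(2 * a 1 * β * γ) := by
  rw [permanent_of_rows]
  simp
  ring


/-! ### Polynomiality along lines (for `forall_eq_zero_or_of_mul₃`) -/

/-- `z ↦ B (φ z) (ψ z)` is polynomial (quadratic) along lines, for bilinear `B` and linear
`φ, ψ`. [folklore] -/
theorem linePoly_bilin {M N P : Type*} [AddCommGroup M] [Module K M] [AddCommGroup N]
    [Module K N] [AddCommGroup P] [Module K P] (B : M →ₗ[K] N →ₗ[K] K) (φ : P →ₗ[K] M)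
    (ψ : P →ₗ[K] N) (z₀ z : P) :
    ∃ p : K[X], ∀ s : K, (fun x => B (φ x) (ψ x)) (z₀ + s • z) = p.eval s := by
  refine ⟨Polynomial.C (B (φ z₀) (ψ z₀)) + Polynomial.C (B (φ z₀) (ψ z) + B (φ z) (ψ z₀)) *
      Polynomial.X + Polynomial.C (B (φ z) (ψ z)) * Polynomial.X ^ 2, fun s => ?_⟩
  simp only [map_add, map_smul, LinearMap.add_apply, LinearMap.smul_apply, smul_eq_mul,
    Polynomial.eval_add, Polynomial.eval_mul, Polynomial.eval_C, Polynomial.eval_X,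
    Polynomial.eval_pow]
  ring

/-- The non-degeneracy polynomial `a₀ a₁ β γ (a₂ γ + a₃ β)` of the family is polynomial along
lines of the parameter space `(a, (β, γ))`. [folklore] -/
theorem linePoly_good (z₀ z : (Fin 4 → K) × (K × K)) :
    ∃ p : K[X], ∀ s : K,
      (fun x : (Fin 4 → K) × (K × K) =>
          x.1 0 * x.1 1 * x.2.1 * x.2.2 * (x.1 2 * x.2.2 + x.1 3 * x.2.1)) (z₀ + s • z) =
        p.eval s := by
  refine ⟨(Polynomial.C (z₀.1 0) + Polynomial.C (z.1 0) * Polynomial.X) *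
      (Polynomial.C (z₀.1 1) + Polynomial.C (z.1 1) * Polynomial.X) *
      (Polynomial.C z₀.2.1 + Polynomial.C z.2.1 * Polynomial.X) *
      (Polynomial.C z₀.2.2 + Polynomial.C z.2.2 * Polynomial.X) *
      ((Polynomial.C (z₀.1 2) + Polynomial.C (z.1 2) * Polynomial.X) *
          (Polynomial.C z₀.2.2 + Polynomial.C z.2.2 * Polynomial.X) +
        (Polynomial.C (z₀.1 3) + Polynomial.C (z.1 3) * Polynomial.X) *
          (Polynomial.C z₀.2.1 + Polynomial.C z.2.1 * Polynomial.X)), fun s => ?_⟩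
  simp only [Prod.fst_add, Prod.snd_add, Prod.smul_fst, Prod.smul_snd, Pi.add_apply,
    Pi.smul_apply, smul_eq_mul, Polynomial.eval_add, Polynomial.eval_mul, Polynomial.eval_C,
    Polynomial.eval_X]
  ring

/-- A vector of `K⁴` with vanishing coordinates `0, 1` is `b₂ e₂ + b₃ e₃`. [folklore] -/
theorem eq_single_add_single (b : Fin 4 → K) (h0 : b 0 = 0) (h1 : b 1 = 0) :
    b = b 2 • Pi.single (2 : Fin 4) (1 : K) + b 3 • Pi.single 3 1 := by
  funext i
  fin_cases i <;> simp [h0, h1]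

/-! ### Column bookkeeping for the family alternatives -/

/-- **Column identities from the first family alternative** (evaluate at `b ∈ {e₂, e₃, e₂+e₃}`
and `a = 0`): the `a`-parts of the columns `2, 3` of the `y₂`-block vanish, and the `b`-parts
satisfy `n₂₂ = n₃₃ = 0`, `n₃₂ = n₂₃`. [folklore] -/
theorem columns_of_caseA
    (t : Fin 8 → (((Fin 4 → K) × (Fin 4 → K)) →ₗ[K] ((Fin 4 → K) × (Fin 4 → K)) →ₗ[K] K))
    (hA : ∀ (a b : Fin 4 → K), b 0 = 0 → b 1 = 0 → ∀ r,
        t r (a, b) (b 2 • Pi.single (2 : Fin 4) (1 : K) - b 3 • Pi.single 3 1, 0) = 0) :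
    (∀ (a : Fin 4 → K) r, t r (a, 0) (Pi.single 2 1, 0) = 0) ∧
    (∀ (a : Fin 4 → K) r, t r (a, 0) (Pi.single 3 1, 0) = 0) ∧
    (∀ r, t r (0, Pi.single 2 1) (Pi.single 2 1, 0) = 0) ∧
    (∀ r, t r (0, Pi.single 3 1) (Pi.single 3 1, 0) = 0) ∧
    (∀ r, t r (0, Pi.single 3 1) (Pi.single 2 1, 0) = t r (0, Pi.single 2 1) (Pi.single 3 1, 0)) := by
  have h2 : ∀ (a : Fin 4 → K) r, t r (a, Pi.single 2 1) (Pi.single 2 1, 0) = 0 := fun a r => by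
    have := hA a (Pi.single 2 1) (by simp) (by simp) r
    simpa using this
  have h3 : ∀ (a : Fin 4 → K) r, t r (a, Pi.single 3 1) (Pi.single 3 1, 0) = 0 := fun a r => by
    have := hA a (Pi.single 3 1) (by simp) (by simp) r
    rw [show ((((Pi.single 3 1 : Fin 4 → K) 2) • Pi.single (2 : Fin 4) (1 : K) -
        ((Pi.single 3 1 : Fin 4 → K) 3) • Pi.single 3 1, (0 : Fin 4 → K)) :
          (Fin 4 → K) × (Fin 4 → K)) = -(Pi.single 3 1, 0) by simp, map_neg, neg_eq_zero] at this
    exact this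
  have h23 : ∀ r, t r (0, Pi.single 2 1 + Pi.single 3 1) (Pi.single 2 1 - Pi.single 3 1, 0) = 0 :=
    fun r => by
    have := hA 0 (Pi.single 2 1 + Pi.single 3 1) (by simp) (by simp) r
    simpa using this
  have hsplit : ∀ (a b : Fin 4 → K) (y : (Fin 4 → K) × (Fin 4 → K)) r,
      t r (a, b) y = t r (a, 0) y + t r (0, b) y := fun a b y r => by
    rw [← LinearMap.add_apply, ← map_add]
    simp
  have n22 : ∀ r, t r (0, Pi.single 2 1) (Pi.single 2 1, 0) = 0 := fun r => h2 0 r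
  have n33 : ∀ r, t r (0, Pi.single 3 1) (Pi.single 3 1, 0) = 0 := fun r => h3 0 r
  refine ⟨fun a r => ?_, fun a r => ?_, n22, n33, fun r => ?_⟩
  · have := h2 a r
    rwa [hsplit, n22, add_zero] at this
  · have := h3 a r
    rwa [hsplit, n33, add_zero] at this
  · have h := h23 r
    rw [show (((0 : Fin 4 → K), (Pi.single 2 1 + Pi.single 3 1 : Fin 4 → K)) :
        (Fin 4 → K) × (Fin 4 → K)) = (0, Pi.single 2 1) + (0, Pi.single 3 1) by simp,
      show (((Pi.single 2 1 - Pi.single 3 1 : Fin 4 → K), (0 : Fin 4 → K)) :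
        (Fin 4 → K) × (Fin 4 → K)) = (Pi.single 2 1, 0) - (Pi.single 3 1, 0) by simp,
      map_add, LinearMap.add_apply, map_sub, map_sub, n22, n33] at h
    linear_combination h

/-- **Column identities from the second family alternative** (the `y₃`-slot version of
`columns_of_caseA`). [folklore] -/
theorem columns_of_caseB
    (t : Fin 8 → (((Fin 4 → K) × (Fin 4 → K)) →ₗ[K] ((Fin 4 → K) × (Fin 4 → K)) →ₗ[K] K))
    (hB : ∀ (a b : Fin 4 → K), b 0 = 0 → b 1 = 0 → ∀ r,
        t r (a, b) (0, b 2 • Pi.single (2 : Fin 4) (1 : K) - b 3 • Pi.single 3 1) = 0) :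
    (∀ (a : Fin 4 → K) r, t r (a, 0) (0, Pi.single 2 1) = 0) ∧
    (∀ (a : Fin 4 → K) r, t r (a, 0) (0, Pi.single 3 1) = 0) ∧
    (∀ r, t r (0, Pi.single 2 1) (0, Pi.single 2 1) = 0) ∧
    (∀ r, t r (0, Pi.single 3 1) (0, Pi.single 3 1) = 0) ∧
    (∀ r, t r (0, Pi.single 3 1) (0, Pi.single 2 1) = t r (0, Pi.single 2 1) (0, Pi.single 3 1)) := by
  have h2 : ∀ (a : Fin 4 → K) r, t r (a, Pi.single 2 1) (0, Pi.single 2 1) = 0 := fun a r => by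
    have := hB a (Pi.single 2 1) (by simp) (by simp) r
    simpa using this
  have h3 : ∀ (a : Fin 4 → K) r, t r (a, Pi.single 3 1) (0, Pi.single 3 1) = 0 := fun a r => by
    have := hB a (Pi.single 3 1) (by simp) (by simp) r
    rw [show (((0 : Fin 4 → K), ((Pi.single 3 1 : Fin 4 → K) 2) • Pi.single (2 : Fin 4) (1 : K) -
        ((Pi.single 3 1 : Fin 4 → K) 3) • Pi.single 3 1) :
          (Fin 4 → K) × (Fin 4 → K)) = -(0, Pi.single 3 1) by simp, map_neg, neg_eq_zero] at this
    exact this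
  have h23 : ∀ r, t r (0, Pi.single 2 1 + Pi.single 3 1) (0, Pi.single 2 1 - Pi.single 3 1) = 0 :=
    fun r => by
    have := hB 0 (Pi.single 2 1 + Pi.single 3 1) (by simp) (by simp) r
    simpa using this
  have hsplit : ∀ (a b : Fin 4 → K) (y : (Fin 4 → K) × (Fin 4 → K)) r,
      t r (a, b) y = t r (a, 0) y + t r (0, b) y := fun a b y r => by
    rw [← LinearMap.add_apply, ← map_add]
    simp
  have n22 : ∀ r, t r (0, Pi.single 2 1) (0, Pi.single 2 1) = 0 := fun r => h2 0 r
  have n33 : ∀ r, t r (0, Pi.single 3 1) (0, Pi.single 3 1) = 0 := fun r => h3 0 r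
  refine ⟨fun a r => ?_, fun a r => ?_, n22, n33, fun r => ?_⟩
  · have := h2 a r
    rwa [hsplit, n22, add_zero] at this
  · have := h3 a r
    rwa [hsplit, n33, add_zero] at this
  · have h := h23 r
    rw [show (((0 : Fin 4 → K), (Pi.single 2 1 + Pi.single 3 1 : Fin 4 → K)) :
        (Fin 4 → K) × (Fin 4 → K)) = (0, Pi.single 2 1) + (0, Pi.single 3 1) by simp,
      show (((0 : Fin 4 → K), (Pi.single 2 1 - Pi.single 3 1 : Fin 4 → K)) :
        (Fin 4 → K) × (Fin 4 → K)) = (0, Pi.single 2 1) - (0, Pi.single 3 1) by simp,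
      map_add, LinearMap.add_apply, map_sub, map_sub, n22, n33] at h
    linear_combination h

end Summit.ValiantsHypothesis.ValiantsHypothesis.Theorems.SymPencilPerFourInnerRankRows

end
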